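import Mathlib
import HarnessLib
import Summits.ResolutionOfSingularities.ResolutionOfSingularities.Theorems.WildQuotientsWildQuotientResolutionToricExitTransfer
import Summits.ResolutionOfSingularities.ResolutionOfSingularities.Theorems.WildQuotientsWildQuotientResolutionBlowupLocalExitThree
import Summits.ResolutionOfSingularities.ResolutionOfSingularities.Theorems.WildQuotientsWildQuotientResolutionBlowupLocalExitClosedThree

/-!
# The toric exit transfer with ONE cone piece and TWO terminal pieces
(crux stmt-ResolutionOfSingularities-15640 `WildQuotients.WildQuotientResolution`, line `Sketch`;
chain w45c post-V5 width target N4a `JordanThreeTwo.jordanThreeTwo_hasResolution`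
(res-L1-w45c-plan-1 NO OBJECTION 2026-08-27T14:24:34Z / 15:17:58Z «stub-2 g5 = N4a PART F»),
part (F1) of res-L1-w45c-stub-2's file plan 15:17:44Z. [OURS · L1 W4.5c] — NOT a statement of any
manuscript; replaces the role of no printed item. Generic glue, def-free.)

`ToricExit.toricExitTransfer₁₂` is the `1 + 2`-piece sibling of `ToricExit.toricExitTransfer`
(p487969, one cone piece + one terminal piece) and of `ToricExit.toricExitTransfer₃` (p498981, two
cone pieces + one terminal piece): the hypothesis-composed skeleton of the N4a final
`jordanThreeTwo_hasResolution` (`𝔸ⁿ/(J₃ ⊕ J₂)`, every `p ≥ 3`). Data: crux data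
`(X', X₁, f, q, G, ρ)` with `|G| = p`, `ρ` faithful, `X₁` AFFINE integral of finite type and of
positive dimension, `q` finite surjective with orbit fibres and generically étale; an equivariant
proper birational integral model `π : V → X'` with action `ρB` over `X₁`; THREE `G`-stable opens
`Oa, Ob, Od` of `V`, affine over `X₁`, covering `V`, with

* pieces `b` and `d` Király–Lütkebohmert terminal: `Ob`, `Od` non-empty and regular, with principal
  stalk augmentation ideals at their fixed points — so `Ob/G`, `Od/G` are regular
  (`ToricExit.isRegular_pieceQuot_of_stalkAug`); in N4a: `Ob = ⋂ g·V[x_b²]`, `Od = V[x_d²]`;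
* piece `a` carrying a closed `Ta ⊆ Oa` (the vertex locus) missing `Ob` and `Od`, such that EVERY
  blow-up of the quotient piece `Oa/G` along the ideal sheaf of the (closed) image of `Ta` is
  regular (in N4a: `Oa/G ≅ ½(1,1,1) × 𝔸ⁿ⁻³`, one blow-up of the reduced vertex, `Half111.blowup_regular`).

Conclusion: `X₁` has a resolution of singularities — the glued quotient `Y = V/G` (Q1, p479608)
is blown up along the ideal sheaf of `π(Ta)` (closed and missing the charts `Ob/G`, `Od/G` by
`BlowupExit.isClosed_gluedMk_image₃`, p492946): over `Oa/G` a regular blow-up, over the regular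
charts `Ob/G`, `Od/G` an isomorphism (`BlowupExit.hasResolution_of_isBlowup_local_of_isOpenImmersion₁₂`
below, from `hasResolution_of_isBlowup_locally_regular`, p486385); resolutions transfer along the
proper birational `Y → X₁` (`QuotientModel.hasResolution_of_hasResolution_glued`).
-/

-- single-problem summit: the doubled namespace component `ResolutionOfSingularities` is forced
set_option linter.dupNamespace false

noncomputable section

universe u

open CategoryTheory AlgebraicGeometry TopologicalSpace
open Literature.AlgebraicGeometry.Resolution Literature.AlgebraicGeometry.RelativeSpec
open Literature.AlgebraicGeometry.CossartPiltant200819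

namespace Summit.ResolutionOfSingularities.ResolutionOfSingularities.Theorems.WildQuotientResolution.BlowupExit

/-- **Three charts: one with regular blow-up, two regular off the centre.** `Y` integral locally
Noetherian, `𝓘 ≠ ⊥`, open immersions `f, g₁, g₂` covering `Y`, `Q₁, Q₂` regular with
`𝓘.comap gᵢ = ⊤`, and SOME blow-up of `P` along `𝓘.comap f` regular ⟹ `HasResolution Y`.
(N4a: `f` = the `μ₂`-vertex piece, `g₁, g₂` = the two K–L pieces of `Bl_I 𝔸ⁿ/σ`.)
[cite: GortzWedhorn2020, Prop. 13.91–13.92] -/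
theorem hasResolution_of_isBlowup_local_of_isOpenImmersion₁₂ {Y P Q₁ Q₂ : Scheme.{u}}
    [IsIntegral Y] [IsLocallyNoetherian Y] (𝓘 : Y.IdealSheafData) (h𝓘 : 𝓘 ≠ ⊥)
    (f : P ⟶ Y) [IsOpenImmersion f] (g₁ : Q₁ ⟶ Y) [IsOpenImmersion g₁]
    (g₂ : Q₂ ⟶ Y) [IsOpenImmersion g₂]
    (hcov : f.opensRange ⊔ g₁.opensRange ⊔ g₂.opensRange = ⊤)
    (hQ₁ : Scheme.IsRegular Q₁) (h𝓘g₁ : 𝓘.comap g₁ = ⊤)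
    (hQ₂ : Scheme.IsRegular Q₂) (h𝓘g₂ : 𝓘.comap g₂ = ⊤)
    (hP : ∃ (B : Scheme.{u}) (p : B ⟶ P), IsBlowup p (𝓘.comap f) ∧ Scheme.IsRegular B) :
    Scheme.HasResolution Y := by
  -- the three charts as opens of `Y`, indexed by `Fin 3`
  let U : Fin 3 → Y.Opens := ![f.opensRange, g₁.opensRange, g₂.opensRange]
  have hU : ⨆ i, U i = ⊤ := by
    rw [eq_top_iff, ← hcov]
    refine sup_le (sup_le ?_ ?_) ?_
    · exact le_iSup U 0
    · exact le_iSup U 1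
    · exact le_iSup U 2
  refine hasResolution_of_isBlowup_locally_regular 𝓘 h𝓘 U hU fun i => ?_
  -- transport of `∃ regular blow-up` along `P ≅ f(P)`
  have key : ∀ {P : Scheme.{u}} (f : P ⟶ Y) [IsOpenImmersion f],
      (∃ (B : Scheme.{u}) (p : B ⟶ P), IsBlowup p (𝓘.comap f) ∧ Scheme.IsRegular B) →
      ∃ (B : Scheme.{u}) (p : B ⟶ (f.opensRange : Scheme.{u})),
        IsBlowup p (𝓘.comap f.opensRange.ι) ∧ Scheme.IsRegular B := by
    intro P f _ hP
    obtain ⟨B, p, hp, hB⟩ := hP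
    refine ⟨B, p ≫ f.isoOpensRange.hom, ?_, hB⟩
    have h' := hp.comp_iso f.isoOpensRange
    rwa [← Scheme.IdealSheafData.comap_comp, Scheme.Hom.isoOpensRange_inv_comp] at h'
  fin_cases i
  · exact key f hP
  · exact key g₁ (exists_isBlowup_regular_of_comap_eq_top' 𝓘 g₁ hQ₁ h𝓘g₁)
  · exact key g₂ (exists_isBlowup_regular_of_comap_eq_top' 𝓘 g₂ hQ₂ h𝓘g₂)

end Summit.ResolutionOfSingularities.ResolutionOfSingularities.Theorems.WildQuotientResolution.BlowupExit

namespace Summit.ResolutionOfSingularities.ResolutionOfSingularities.Theorems.WildQuotientResolution.ToricExit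

-- the glued-quotient / blow-up bookkeeping is individually cheap but numerous
set_option maxHeartbeats 800000 in
/-- **The toric exit transfer, one cone piece and two terminal pieces.** Let `(X', X₁, f, q, G, ρ)`
be crux data with `|G| = p`, `ρ` faithful, `X₁` affine, integral, of finite type over `k` and of
positive dimension, `q` finite surjective with orbit fibres and étale over a dense open;
`π : V → X'` an equivariant proper birational integral model with action `ρB` over `X₁`;
`Oa, Ob, Od` three `G`-stable opens of `V`, affine over `X₁`, with `Oa ∪ Ob ∪ Od = V`; `Ob` and `Od`
non-empty, regular, with principal stalk augmentation ideals at their fixed points; `Ta ⊆ Oa` closed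
in `V` and disjoint from `Ob` and `Od`, such that every blow-up of the quotient piece `Oa/G` along
the ideal sheaf of the image of `Ta` is regular. Then `X₁` has a resolution of singularities.
[OURS · L1 W4.5c] [folklore; assembly of landed decls] -/
theorem toricExitTransfer₁₂ (p : ℕ) (hp : p.Prime) (k : Type) [Field k]
    (X' X₁ : Scheme.{0}) (f : X₁ ⟶ Spec (.of k)) (q : X' ⟶ X₁) (G : Type) [Group G] [Finite G]
    (ρ : G →* Aut X') (hcard : Nat.card G = p) (hfaith : Function.Injective ρ)
    [IsAffine X₁] [LocallyOfFiniteType f] [IsIntegral X₁] [IsIntegral X']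
    [IsFinite q] (hdim : ¬ topologicalKrullDim X₁ ≤ 0) (hsurj : Function.Surjective q.base)
    (hU : ∃ U : X₁.Opens, Dense (U : Set X₁) ∧ Etale (q ∣_ U))
    (horb : ∀ x y : X', q.base x = q.base y → ∃ g : G, (ρ g).hom.base x = y)
    (V : Scheme.{0}) (π : V ⟶ X') [IsProper π] (hbir : IsBirational π) [IsIntegral V]
    (ρB : ActionOver (π ≫ q) G)
    (hequiv : ∀ g : G, (ρB.aut g).hom ≫ π = π ≫ (ρ g).hom)
    (Oa Ob Od : ρB.StableAffineOpens) (hcov₃ : Oa.1 ⊔ Ob.1 ⊔ Od.1 = ⊤)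
    (hObne : ((Ob.1 : V.Opens) : Set V).Nonempty)
    (hregb : Scheme.IsRegular (Ob.1 : Scheme.{0}))
    (hdivb : ∀ (g : G) (v : V) (hv : (ρB.aut g).hom.base v = v), v ∈ (Ob.1 : V.Opens) →
      (Ideal.span (Set.range fun s : V.presheaf.stalk v =>
        (V.presheaf.stalkSpecializes (specializes_of_eq hv) ≫ (ρB.aut g).hom.stalkMap v).hom s -
          s)).IsPrincipal)
    (hOdne : ((Od.1 : V.Opens) : Set V).Nonempty)
    (hregd : Scheme.IsRegular (Od.1 : Scheme.{0}))
    (hdivd : ∀ (g : G) (v : V) (hv : (ρB.aut g).hom.base v = v), v ∈ (Od.1 : V.Opens) →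
      (Ideal.span (Set.range fun s : V.presheaf.stalk v =>
        (V.presheaf.stalkSpecializes (specializes_of_eq hv) ≫ (ρB.aut g).hom.stalkMap v).hom s -
          s)).IsPrincipal)
    (Ta : Set V) (hTa : IsClosed Ta) (hTa1 : Ta ⊆ ((Oa.1 : V.Opens) : Set V))
    (hTa2 : Disjoint Ta ((Ob.1 : V.Opens) : Set V)) (hTa3 : Disjoint Ta ((Od.1 : V.Opens) : Set V))
    (hPa : ∀ (Za : Closeds (ρB.pieceQuot Oa)),
      (Za : Set (ρB.pieceQuot Oa)) = (ρB.pieceMk Oa).base '' (Oa.1.ι.base ⁻¹' Ta) →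
      ∀ (B : Scheme.{0}) (pB : B ⟶ ρB.pieceQuot Oa),
        IsBlowup pB (Scheme.IdealSheafData.vanishingIdeal Za) → Scheme.IsRegular B) :
    Scheme.HasResolution X₁ := by
  classical
  -- separatedness and noetherianity
  haveI : X₁.IsSeparated := inferInstance
  haveI : X'.IsSeparated := ⟨by rw [← Limits.terminal.comp_from q]; infer_instance⟩
  haveI : IsLocallyNoetherian X₁ := LocallyOfFiniteType.isLocallyNoetherian f
  -- the cover by `G`-stable opens affine over `X₁`
  have hcov : ∀ v : V, ∃ O : ρB.StableAffineOpens, v ∈ O.1 := by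
    intro v
    have hv : v ∈ Oa.1 ⊔ Ob.1 ⊔ Od.1 := by rw [hcov₃]; exact Opens.mem_top v
    rcases Opens.mem_sup.mp hv with h | h
    · rcases Opens.mem_sup.mp h with h | h
      · exact ⟨Oa, h⟩
      · exact ⟨Ob, h⟩
    · exact ⟨Od, h⟩
  -- `Y = V/G`: integral, proper and birational over `X₁`
  obtain ⟨hY, hr, hrbir⟩ := QuotientModel.quotientModel_proper_birational k X' X₁ f q G ρ hfaith
    hdim hsurj hU horb V π hbir ρB hequiv hcov
  haveI := hY
  haveI : IsLocallyNoetherian ρB.glued :=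
    LocallyOfFiniteType.isLocallyNoetherian (ρB.gluedDesc (π ≫ q) ρB.aut_comp ≫ f)
  -- the three charts of `Y`
  have hcovU : (ρB.gluedι Oa).opensRange ⊔ (ρB.gluedι Ob).opensRange ⊔
      (ρB.gluedι Od).opensRange = ⊤ :=
    BlowupExit.opensRange_gluedι_sup₃_eq_top ρB hcov Oa Ob Od hcov₃
  -- pieces `b` and `d` are regular
  have hQb : Scheme.IsRegular (ρB.pieceQuot Ob) :=
    isRegular_pieceQuot_of_stalkAug ρB hp hcard Ob hObne hregb hdivb
  have hQd : Scheme.IsRegular (ρB.pieceQuot Od) :=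
    isRegular_pieceQuot_of_stalkAug ρB hp hcard Od hOdne hregd hdivd
  -- the centre: the (closed) image of `Ta` in `Y`, missing the charts `Ob/G`, `Od/G`
  obtain ⟨hZcl, hZdisjb, hZdisjd⟩ :=
    BlowupExit.isClosed_gluedMk_image₃ ρB hcov Oa Ob Od hcov₃ Ta hTa hTa1 hTa2 hTa3
  let Z : Closeds ρB.glued := ⟨(ρB.gluedMk hcov).base '' Ta, hZcl⟩
  have h𝓘gb : (Scheme.IdealSheafData.vanishingIdeal Z).comap (ρB.gluedι Ob) = ⊤ :=
    BlowupExit.comap_vanishingIdeal_eq_top_of_disjoint Z (ρB.gluedι Ob)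
      (by
        have h : Disjoint (Set.range (ρB.gluedι Ob).base) ((ρB.gluedMk hcov).base '' Ta) := by
          simpa only [Scheme.Hom.coe_opensRange] using hZdisjb.symm
        exact h)
  have h𝓘gd : (Scheme.IdealSheafData.vanishingIdeal Z).comap (ρB.gluedι Od) = ⊤ :=
    BlowupExit.comap_vanishingIdeal_eq_top_of_disjoint Z (ρB.gluedι Od)
      (by
        have h : Disjoint (Set.range (ρB.gluedι Od).base) ((ρB.gluedMk hcov).base '' Ta) := by
          simpa only [Scheme.Hom.coe_opensRange] using hZdisjd.symm
        exact h)
  -- `𝓘_Z ≠ ⊥`: the non-empty chart `Ob/G` misses `Z`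
  have h𝓘 : Scheme.IdealSheafData.vanishingIdeal Z ≠ ⊥ := by
    apply CP2008.vanishingIdeal_ne_bot_of_ne_univ
    obtain ⟨v, hv⟩ := hObne
    intro huniv
    have hmem : ρB.gluedMk hcov v ∈ (Z : Set ρB.glued) := by rw [huniv]; trivial
    have hrange : ρB.gluedMk hcov v ∈ ((ρB.gluedι Ob).opensRange : Set ρB.glued) := by
      change v ∈ ρB.gluedMk hcov ⁻¹ᵁ (ρB.gluedι Ob).opensRange
      rw [ρB.preimage_opensRange_gluedι hcov Ob]
      exact hv
    exact Set.disjoint_left.mp hZdisjb hmem hrange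
  -- the preimage of `Z` in the chart `Oa/G` is the image of `Ta ∩ Oa`
  have hZpre : ((Z.preimage (ρB.gluedι Oa).continuous : Closeds (ρB.pieceQuot Oa)) :
      Set (ρB.pieceQuot Oa)) = (ρB.pieceMk Oa).base '' (Oa.1.ι.base ⁻¹' Ta) := by
    ext y
    simp only [Closeds.coe_preimage, Set.mem_preimage, Set.mem_image]
    constructor
    · rintro ⟨t, ht, hty⟩
      refine ⟨⟨t, hTa1 ht⟩, ht, ?_⟩
      apply (ρB.gluedι Oa).isOpenEmbedding.injective
      rw [← hty]
      exact (ρB.gluedMk_apply hcov Oa ⟨t, hTa1 ht⟩).symm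
    · rintro ⟨x, hx, rfl⟩
      exact ⟨x.1, hx, ρB.gluedMk_apply hcov Oa x⟩
  -- the blow-up of the chart `Oa/G` along the pulled-back centre is regular
  have hP : ∃ (B : Scheme.{0}) (pB : B ⟶ ρB.pieceQuot Oa),
      IsBlowup pB ((Scheme.IdealSheafData.vanishingIdeal Z).comap (ρB.gluedι Oa)) ∧
        Scheme.IsRegular B := by
    rw [comap_vanishingIdeal_of_isOpenImmersion]
    obtain ⟨B, pB, hpB⟩ := exists_isBlowup (ρB.pieceQuot Oa)
      (Scheme.IdealSheafData.vanishingIdeal (Z.preimage (ρB.gluedι Oa).continuous))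
    exact ⟨B, pB, hpB, hPa _ hZpre B pB hpB⟩
  -- the exit downstairs, transported along `Y → X₁`
  have hres : Scheme.HasResolution ρB.glued :=
    BlowupExit.hasResolution_of_isBlowup_local_of_isOpenImmersion₁₂
      (Scheme.IdealSheafData.vanishingIdeal Z) h𝓘 (ρB.gluedι Oa) (ρB.gluedι Ob) (ρB.gluedι Od)
      hcovU hQb h𝓘gb hQd h𝓘gd hP
  exact QuotientModel.hasResolution_of_hasResolution_glued k X' X₁ f q G ρ hfaith hdim hsurj hU
    horb V π hbir ρB hequiv hcov hres

end Summit.ResolutionOfSingularities.ResolutionOfSingularities.Theorems.WildQuotientResolution.ToricExit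

end
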